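import Summits.AtomisticToContinuum.BoseEinsteinCondensation.Theorems.BECCutLineWeakDisorderGroundStateRigidityStubClosedEnergyTruncHardCoreAux
import Summits.AtomisticToContinuum.BoseEinsteinCondensation.Theorems.BECCutLineWeakDisorderGroundStateRigidityStubCoreCutoff
import Summits.AtomisticToContinuum.BoseEinsteinCondensation.Theorems.BECCutLineWeakDisorderGroundStateRigidityStubShellMassOfCutoff
import Summits.AtomisticToContinuum.BoseEinsteinCondensation.Theorems.BECCutLineWeakDisorderGroundStateRigidityStubLayerKineticVanishing
import Summits.AtomisticToContinuum.BoseEinsteinCondensation.Theorems.BECCutLineWeakDisorderGroundStateRigidityStubKineticCauchy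
import Summits.AtomisticToContinuum.BoseEinsteinCondensation.Theorems.BECCutLineWeakDisorderGroundStateRigidityStubTruncDiagonal
import HarnessLib

/-!
# BECHardSphereReduction / HardCoreDominates — the closed hard-sphere energy of a function
# vanishing on the cores (stub `stub_hardSphereClosedEnergy`, 2b-D, of line `birth`)

Crux `HardCoreDominates` (stmt-AtomisticToContinuum-11884) of route `BECHardSphereReduction`, line
`birth` (lead c1). This file proves the registered stub `stub_hardSphereClosedEnergy`, B. Simon's
"maximal form = minimal form" for the Dirichlet hard-sphere Hamiltonian in the tree's sequential
vocabulary (`closedEnergy` of `Literature/…/GroundState.lean`):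

  for a measurable `Ψ : (ℝ³)^N → ℂ` vanishing a.e. on the core set `K_R = {∃ i ≠ j, |xᵢ - xⱼ| ≤ R}`,
  `closedEnergy HS_R L Ψ ≤ closedEnergy 0 L Ψ`, `HS_R = ⊤ · 1_{(-∞, R]}` (hard spheres).

## Proof

Nothing to do if `S := closedEnergy 0 L Ψ = ⊤`. Otherwise we run the cut-off machine that the
sibling crux `GroundStateRigidity` (route `BECCutLineWeakDisorder`) landed for the closed-form
energy truncation of the hard-core class (`ClosedEnergyTrunc.one_step` and the stubs 15a
`stub_coreCutoff`, 15b `stub_shellMassOfCutoff`, 15c `stub_kineticCauchy`, 15d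
`stub_layerKineticVanishing`, `LincombGS.exists_trialState_normalize`, `ExistsNonneg.*`), for the
potential `v = HS_R` (`= ⊤` on `[0, R]`, `= 0 ≤ C := 0` beyond `R`) and its truncations
`v ⊓ m = m · 1_{(-∞,R]}`:

* DIAGONAL APPROXIMANTS (`HardSphereClosedEnergy.exists_diag`). Since `Ψ = 0` a.e. on `K_R`, the
  core mass of any `F` is at most its `L²`-distance to `Ψ` (`lintegral_core_le`), and
  `energy (v ⊓ m) T ≤ energy 0 T + m N² ∫_{K_R} |T|²` (`energy_trunc_le`). Unfolding the infimum
  `closedEnergy 0 L Ψ < S + ε/2` with an `L²`-tolerance `δ = (ε/2)/(m N² + 1)` therefore gives trial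
  states `Φ m → Ψ` with `energy (v ⊓ m) (Φ m) ≤ S + 1/(m+1)` and `∫|Φ m - Ψ|² ≤ 1/(m+1)`.
* They are Cauchy in kinetic energy (`stub_kineticCauchy` for the increasing family `v ⊓ m`, whose
  member `v ⊓ 0 = 0` already has closed energy `S`).
* `ClosedEnergyTrunc.one_step` then produces, for `θ = τ = 1/(k+1)`, `C¹` Dirichlet symmetric cut
  states `G_k = χ Φ_m` VANISHING ON THE CORES with `∫|G_k - Ψ|² ≤ 4τ` and hard-sphere form
  `Q_v(G_k) ≤ (1+θ)(S+τ) + τ`; normalising (`LincombGS.exists_trialState_normalize`, masses `→ 1` by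
  `ExistsNonneg.tendsto_lintegral_nnnorm_sq`) yields trial states `Θ_k → Ψ` in `L²` with
  `limsup energy v Θ_k ≤ S`, and `closedEnergy_le_liminf` concludes. (This last paragraph is the
  bookkeeping of `stub_closedEnergyTruncHardCore`, verbatim.)

No case distinction on `N` or on the sign of `L` is needed (for `N ≥ 1`, `L ≤ 0` there are no trial
states and `S = ⊤`).
-/

noncomputable section

open MeasureTheory Filter Set Metric
open scoped ENNReal NNReal Topology

namespace Summit.AtomisticToContinuum.BoseEinsteinCondensation.Cruxes.HardCoreDominates.Birth

open Literature.MathematicalPhysics.QuantumManyBody.BoseGas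
open Literature.Analysis.FunctionSpaces (tendsto_inv_natCast_add_one)
open Summit.AtomisticToContinuum.BoseEinsteinCondensation.Theorems.GroundStateRigidity

namespace HardSphereClosedEnergy

variable {N : ℕ} {L : ℝ}

/-- `energy 0 Φ = ∫ |∇Φ|²` (no interaction). [folklore] -/
theorem energy_zero_eq (Φ : TrialState N L) : energy 0 Φ = ∫⁻ X, kineticDensity Φ.ψ X := by
  simp [energy, interaction]

/-- **Core mass of an approximant.** If `Ψ = 0` a.e. on the core set `K_R`, then for every `F`
`∫_{K_R} |F|² ≤ ∫ |F - Ψ|²` (on `K_R`, `|F| = |F - Ψ|` a.e.). [folklore] -/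
theorem lintegral_core_le {R : ℝ} {Ψ : Config N → ℂ}
    (hcore : ∀ᵐ X : Config N, (∃ i j : Fin N, i ≠ j ∧ dist (X i) (X j) ≤ R) → Ψ X = 0)
    (F : Config N → ℂ) :
    ∫⁻ X, {Y : Config N | ∃ i j : Fin N, i ≠ j ∧ dist (Y i) (Y j) ≤ R}.indicator
        (fun Y => (‖F Y‖₊ : ℝ≥0∞) ^ 2) X ≤ ∫⁻ X, (‖F X - Ψ X‖₊ : ℝ≥0∞) ^ 2 := by
  refine lintegral_mono_ae (hcore.mono fun X hX => ?_)
  by_cases hK : X ∈ {Y : Config N | ∃ i j : Fin N, i ≠ j ∧ dist (Y i) (Y j) ≤ R}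
  · rw [indicator_of_mem hK, hX hK, sub_zero]
  · rw [indicator_of_notMem hK]
    exact zero_le

/-- **The truncated hard-core interaction lives on the core set**: for `v = 0` beyond `R`,
`(∑_{i<j} (v ⊓ m)(|xᵢ - xⱼ|)) |F(X)|² ≤ m N² 1_{K_R}(X) |F(X)|²` (at most `N²` pair terms, each
`≤ m`; off `K_R` every pair is `> R` apart and the interaction vanishes). [folklore] -/
theorem interaction_trunc_mul_le {v : ℝ → ℝ≥0∞} {R : ℝ} (hfar : ∀ t : ℝ, R < t → v t = 0) (m : ℕ)
    (F : Config N → ℂ) (X : Config N) :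
    interaction (fun r => min (v r) (m : ℝ≥0∞)) X * (‖F X‖₊ : ℝ≥0∞) ^ 2 ≤
      (m : ℝ≥0∞) * ((N : ℝ≥0∞) * N) *
        {Y : Config N | ∃ i j : Fin N, i ≠ j ∧ dist (Y i) (Y j) ≤ R}.indicator
          (fun Y => (‖F Y‖₊ : ℝ≥0∞) ^ 2) X := by
  by_cases hK : X ∈ {Y : Config N | ∃ i j : Fin N, i ≠ j ∧ dist (Y i) (Y j) ≤ R}
  · rw [indicator_of_mem hK]
    refine mul_le_mul' ?_ le_rfl
    unfold interaction
    calc ∑ i : Fin N, ∑ j ∈ Finset.univ.filter (fun j => i < j),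
          min (v (dist (X i) (X j))) (m : ℝ≥0∞)
        ≤ ∑ i : Fin N, ∑ j ∈ Finset.univ.filter (fun j => i < j), (m : ℝ≥0∞) :=
          Finset.sum_le_sum fun i _ => Finset.sum_le_sum fun j _ => min_le_right _ _
      _ ≤ ∑ _i : Fin N, ∑ _j : Fin N, (m : ℝ≥0∞) :=
          Finset.sum_le_sum fun i _ => Finset.sum_le_sum_of_subset (Finset.filter_subset _ _)
      _ = (m : ℝ≥0∞) * ((N : ℝ≥0∞) * N) := by
          simp only [Finset.sum_const, Finset.card_univ, Fintype.card_fin, nsmul_eq_mul]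
          ring
  · have hX : ∀ i j : Fin N, i < j → R < dist (X i) (X j) := fun i j hij =>
      not_le.1 fun h => hK ⟨i, j, hij.ne, h⟩
    have hw : ∀ r : ℝ, R < r → min (v r) (m : ℝ≥0∞) = 0 := fun r hr => by
      rw [hfar r hr]
      exact min_eq_left zero_le
    rw [interaction_eq_zero_of_lt_dist hw hX, zero_mul]
    exact zero_le

/-- **Truncated hard-sphere energy of a trial state**:
`energy (v ⊓ m) T ≤ energy 0 T + m N² ∫_{K_R} |T|²` (`interaction_trunc_mul_le` integrated).
[folklore] -/
theorem energy_trunc_le {v : ℝ → ℝ≥0∞} {R : ℝ} (hfar : ∀ t : ℝ, R < t → v t = 0) (m : ℕ)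
    (T : TrialState N L) :
    energy (fun r => min (v r) (m : ℝ≥0∞)) T ≤
      energy 0 T + (m : ℝ≥0∞) * ((N : ℝ≥0∞) * N) *
        ∫⁻ X, {Y : Config N | ∃ i j : Fin N, i ≠ j ∧ dist (Y i) (Y j) ≤ R}.indicator
          (fun Y => (‖T.ψ Y‖₊ : ℝ≥0∞) ^ 2) X := by
  rw [energy_zero_eq, ← lintegral_const_mul' _ _ (by finiteness),
    ← lintegral_add_left (measurable_kineticDensity T.contDiff)]
  exact lintegral_mono fun X => add_le_add le_rfl (interaction_trunc_mul_le hfar m T.ψ X)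

/-- **Diagonal approximants for the truncated hard spheres.** If `S = closedEnergy 0 L Ψ < ⊤` and
`Ψ = 0` a.e. on `K_R` (`v = 0` beyond `R`), there are trial states `Φ m` with
`energy (v ⊓ m) (Φ m) ≤ S + 1/(m+1)` and `∫|Φ m - Ψ|² ≤ 1/(m+1)`: unfold the infimum
`closedEnergy 0 L Ψ < S + ε/2` (`TruncDiagonal.exists_trialState_energy_lt_of_closedEnergy_lt`) with
`L²`-tolerance `δ = (ε/2)/(m N² + 1)`, and use `energy (v ⊓ m) T ≤ energy 0 T + m N² ∫_{K_R}|T|²`,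
`∫_{K_R}|T|² ≤ ∫|T - Ψ|² ≤ δ`. [cite: Kato1966, VI §1.4 Thm 1.17] -/
theorem exists_diag {v : ℝ → ℝ≥0∞} {R : ℝ} (hfar : ∀ t : ℝ, R < t → v t = 0) {Ψ : Config N → ℂ}
    (hS : closedEnergy 0 L Ψ ≠ ⊤)
    (hcore : ∀ᵐ X : Config N, (∃ i j : Fin N, i ≠ j ∧ dist (X i) (X j) ≤ R) → Ψ X = 0) :
    ∃ Φ : ℕ → TrialState N L,
      (∀ m : ℕ, energy (fun r => min (v r) (m : ℝ≥0∞)) (Φ m) ≤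
        closedEnergy 0 L Ψ + ((m : ℝ≥0∞) + 1)⁻¹) ∧
      ∀ m : ℕ, ∫⁻ X, (‖(Φ m).ψ X - Ψ X‖₊ : ℝ≥0∞) ^ 2 ≤ ((m : ℝ≥0∞) + 1)⁻¹ := by
  have key : ∀ m : ℕ, ∃ T : TrialState N L,
      energy (fun r => min (v r) (m : ℝ≥0∞)) T ≤ closedEnergy 0 L Ψ + ((m : ℝ≥0∞) + 1)⁻¹ ∧
        ∫⁻ X, (‖T.ψ X - Ψ X‖₊ : ℝ≥0∞) ^ 2 ≤ ((m : ℝ≥0∞) + 1)⁻¹ := by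
    intro m
    set ε : ℝ≥0∞ := ((m : ℝ≥0∞) + 1)⁻¹ with hε_def
    have hε0 : ε ≠ 0 := ENNReal.inv_ne_zero.2 (by finiteness)
    have hε2 : ε / 2 ≠ 0 := (ENNReal.div_pos hε0 ENNReal.ofNat_ne_top).ne'
    set c : ℝ≥0∞ := (m : ℝ≥0∞) * ((N : ℝ≥0∞) * N) with hc_def
    have hc1 : c + 1 ≠ ⊤ := by rw [hc_def]; finiteness
    set δ : ℝ≥0∞ := (ε / 2) / (c + 1) with hδ_def
    have hδ0 : 0 < δ := ENNReal.div_pos hε2 hc1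
    have hcδ : c * δ ≤ ε / 2 :=
      calc c * δ ≤ (c + 1) * δ := mul_le_mul' le_self_add le_rfl
        _ ≤ ε / 2 := ENNReal.mul_div_le
    have hδε : δ ≤ ε :=
      calc δ ≤ (ε / 2) / 1 := ENNReal.div_le_div_left le_add_self _
        _ = ε / 2 := div_one _
        _ ≤ ε := ENNReal.half_le_self
    have hlt : closedEnergy 0 L Ψ < closedEnergy 0 L Ψ + ε / 2 := ENNReal.lt_add_right hS hε2
    obtain ⟨T, hTE, hTd⟩ :=
      TruncDiagonal.exists_trialState_energy_lt_of_closedEnergy_lt hlt hδ0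
    refine ⟨T, ?_, hTd.trans hδε⟩
    calc energy (fun r => min (v r) (m : ℝ≥0∞)) T
        ≤ energy 0 T + c * ∫⁻ X, {Y : Config N | ∃ i j : Fin N, i ≠ j ∧
            dist (Y i) (Y j) ≤ R}.indicator (fun Y => (‖T.ψ Y‖₊ : ℝ≥0∞) ^ 2) X :=
          energy_trunc_le hfar m T
      _ ≤ (closedEnergy 0 L Ψ + ε / 2) + c * δ :=
          add_le_add hTE.le (mul_le_mul' le_rfl ((lintegral_core_le hcore T.ψ).trans hTd))
      _ ≤ (closedEnergy 0 L Ψ + ε / 2) + ε / 2 := add_le_add le_rfl hcδ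
      _ = closedEnergy 0 L Ψ + ε := by rw [add_assoc, ENNReal.add_halves]
  choose Φ hΦ using key
  exact ⟨Φ, fun m => (hΦ m).1, fun m => (hΦ m).2⟩

/-- **The closed hard-core energy of a function vanishing on the cores** (general hard-core class
with nothing outside the core: `v` measurable, `= ⊤` on `[0, R]`, `= 0` beyond `R`): if `Ψ` is
measurable and `Ψ = 0` a.e. on `K_R`, then `closedEnergy v L Ψ ≤ closedEnergy 0 L Ψ`. Diagonal
approximants (`exists_diag`), kinetic Cauchy property (`stub_kineticCauchy`), one cut state per
tolerance (`ClosedEnergyTrunc.one_step` with `stub_coreCutoff`, `stub_shellMassOfCutoff`,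
`stub_layerKineticVanishing`), normalisation and `closedEnergy_le_liminf`.
[cite: Kato1966, VI §1.3 Thm 1.16] -/
theorem closedEnergy_le_of_ae_vanish {v : ℝ → ℝ≥0∞} {R : ℝ} (hR : 0 < R) (hv : Measurable v)
    (hcore : ∀ t : ℝ, t ∈ Set.Icc 0 R → v t = ⊤) (hfar : ∀ t : ℝ, R < t → v t = 0)
    {Ψ : Config N → ℂ} (hΨ : Measurable Ψ)
    (hcoreΨ : ∀ᵐ X : Config N, (∃ i j : Fin N, i ≠ j ∧ dist (X i) (X j) ≤ R) → Ψ X = 0) :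
    closedEnergy v L Ψ ≤ closedEnergy 0 L Ψ := by
  rcases eq_or_ne (closedEnergy 0 L Ψ) ⊤ with hST | hST
  · rw [hST]; exact le_top
  have hC : ∀ t : ℝ, R < t → v t ≤ ((0 : ℝ≥0) : ℝ≥0∞) := fun t ht => (hfar t ht).trans_le zero_le
  have hw0 : (fun r => min (v r) ((0 : ℕ) : ℝ≥0∞)) = 0 := by
    funext r
    rw [Nat.cast_zero]
    exact min_eq_right zero_le
  obtain ⟨A, hA⟩ := stub_coreCutoff N
  -- diagonal approximants and their `L²` limit
  obtain ⟨Φ, hΦE, hΦd⟩ := exists_diag (L := L) hfar hST hcoreΨ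
  set S : ℝ≥0∞ := closedEnergy 0 L Ψ with hS_def
  have hΦΨ : TendstoL2 Φ Ψ := tendsto_of_tendsto_of_tendsto_of_le_of_le tendsto_const_nhds
    tendsto_inv_natCast_add_one (fun _ => zero_le) hΦd
  have hΨ1 : ∫⁻ X, (‖Ψ X‖₊ : ℝ≥0∞) ^ 2 = 1 :=
    hΦΨ.lintegral_nnnorm_sq_eq_one hΨ.aestronglyMeasurable
  -- the kinetic Cauchy property (Stub 15c for the increasing family `v ⊓ m`)
  have hE : ∀ δ : ℝ≥0∞, 0 < δ → ∀ᶠ m : ℕ in atTop,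
      energy (fun r => min (v r) (m : ℝ≥0∞)) (Φ m) ≤ S + δ := fun δ hδ =>
    (tendsto_inv_natCast_add_one.eventually_le_const hδ).mono fun m hm =>
      (hΦE m).trans (add_le_add le_rfl hm)
  have hCδ : ∀ δ : ℝ≥0∞, 0 < δ → ∃ m₀ : ℕ,
      S ≤ closedEnergy (fun r => min (v r) (m₀ : ℝ≥0∞)) L Ψ + δ := fun δ _ =>
    ⟨0, by rw [hw0, hS_def]; exact le_self_add⟩
  have hCauchy := stub_kineticCauchy N L (fun (m : ℕ) r => min (v r) (m : ℝ≥0∞)) Φ Ψ S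
    (fun m => hv.min measurable_const) (fun m m' hmm' r => min_le_min_left (v r)
      (by exact_mod_cast hmm')) hST hΨ hΦΨ hE hCδ
  -- the cut states `Gₖ` (`θₖ = τₖ = 1/(k+1)`)
  have hτk : ∀ k : ℕ, (0 : ℝ≥0∞) < ((k : ℝ≥0∞) + 1)⁻¹ := fun k =>
    ENNReal.inv_pos.2 (by finiteness)
  have step : ∀ k : ℕ, ∃ G : Config N → ℂ, ContDiff ℝ 1 G ∧ (∀ X, X ∉ boxN N L → G X = 0) ∧
      (∀ (σ : Equiv.Perm (Fin N)) (X : Config N), G (X ∘ σ) = G X) ∧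
      ∫⁻ X, (‖G X - Ψ X‖₊ : ℝ≥0∞) ^ 2 ≤ 4 * ((k : ℝ≥0∞) + 1)⁻¹ ∧
      ∫⁻ X, kineticDensity G X + interaction v X * (‖G X‖₊ : ℝ≥0∞) ^ 2 ≤
        ENNReal.ofReal (1 + 1 / ((k : ℝ) + 1)) * (S + ((k : ℝ≥0∞) + 1)⁻¹) +
          ((k : ℝ≥0∞) + 1)⁻¹ := fun k =>
    ClosedEnergyTrunc.one_step hA (fun s η ψ i j => stub_shellMassOfCutoff N R s A η ψ i j)
      (stub_layerKineticVanishing N R) hR hv hcore hC hST hΦE hΦd hCauchy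
      Nat.one_div_pos_of_nat (hτk k)
  choose G hGc hG0 hGσ hGd hGQ using step
  -- `Gₖ → Ψ` in `L²`, so the masses tend to `1`
  have hGF : Tendsto (fun k => ∫⁻ X, (‖G k X - Ψ X‖₊ : ℝ≥0∞) ^ 2) atTop (𝓝 0) := by
    have h := ENNReal.Tendsto.const_mul tendsto_inv_natCast_add_one (Or.inr ENNReal.ofNat_ne_top)
      (a := (4 : ℝ≥0∞))
    rw [mul_zero] at h
    exact tendsto_of_tendsto_of_tendsto_of_le_of_le tendsto_const_nhds h (fun _ => zero_le) hGd
  have hm : Tendsto (fun k => ∫⁻ X, (‖G k X‖₊ : ℝ≥0∞) ^ 2) atTop (𝓝 1) :=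
    ExistsNonneg.tendsto_lintegral_nnnorm_sq (fun k => (hGc k).continuous.aestronglyMeasurable)
      hΨ.aestronglyMeasurable hΨ1 hGF
  -- the raw-form bounds tend to `S`
  have hB : Tendsto (fun k : ℕ => ENNReal.ofReal (1 + 1 / ((k : ℝ) + 1)) *
      (S + ((k : ℝ≥0∞) + 1)⁻¹) + ((k : ℝ≥0∞) + 1)⁻¹) atTop (𝓝 S) := by
    have h1 : Tendsto (fun k : ℕ => ENNReal.ofReal (1 + 1 / ((k : ℝ) + 1))) atTop (𝓝 1) := by
      have h := ENNReal.tendsto_ofReal (tendsto_one_div_add_atTop_nhds_zero_nat.const_add (1 : ℝ))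
      rwa [add_zero, ENNReal.ofReal_one] at h
    have h2 : Tendsto (fun k : ℕ => S + ((k : ℝ≥0∞) + 1)⁻¹) atTop (𝓝 S) := by
      have h := tendsto_inv_natCast_add_one.const_add S
      rwa [add_zero] at h
    have h3 := ENNReal.Tendsto.mul h1 (Or.inl one_ne_zero) h2 (Or.inr ENNReal.one_ne_top)
    rw [one_mul] at h3
    have h4 := h3.add tendsto_inv_natCast_add_one
    rwa [add_zero] at h4
  -- the normalised cut states (junk where the mass vanishes, finitely often)
  choose Θ hΘ _hlow using fun k =>
    LincombGS.exists_trialState_normalize (Φ 0) v (hGc k) (hG0 k) (hGσ k)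
  have hev : ∀ᶠ k in atTop, ∫⁻ X, (‖G k X‖₊ : ℝ≥0∞) ^ 2 ≠ 0 := hm.eventually_ne one_ne_zero
  have hΘΨ : TendstoL2 Θ Ψ := by
    have hcst : Tendsto (fun k => Real.sqrt ((∫⁻ X, (‖G k X‖₊ : ℝ≥0∞) ^ 2).toReal)⁻¹) atTop
        (𝓝 1) := by
      have h1' := (ENNReal.tendsto_toReal ENNReal.one_ne_top).comp hm
      rw [ENNReal.toReal_one] at h1'
      have h2' := (Real.continuous_sqrt.tendsto _).comp (h1'.inv₀ one_ne_zero)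
      rwa [inv_one, Real.sqrt_one] at h2'
    refine (ExistsNonneg.tendsto_lintegral_const_mul_sub (G := G) hΨ hΨ1 hcst hGF).congr'
      (hev.mono fun k hk => ?_)
    beta_reduce
    rw [(hΘ k hk).1]
  have hEΘ : ∀ᶠ k in atTop, energy v (Θ k) ≤ (∫⁻ X, (‖G k X‖₊ : ℝ≥0∞) ^ 2)⁻¹ *
      (ENNReal.ofReal (1 + 1 / ((k : ℝ) + 1)) * (S + ((k : ℝ≥0∞) + 1)⁻¹) +
        ((k : ℝ≥0∞) + 1)⁻¹) :=
    hev.mono fun k hk => by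
      rw [(hΘ k hk).2]
      exact mul_le_mul' le_rfl (hGQ k)
  have hlim : Tendsto (fun k : ℕ => (∫⁻ X, (‖G k X‖₊ : ℝ≥0∞) ^ 2)⁻¹ *
      (ENNReal.ofReal (1 + 1 / ((k : ℝ) + 1)) * (S + ((k : ℝ≥0∞) + 1)⁻¹) +
        ((k : ℝ≥0∞) + 1)⁻¹)) atTop (𝓝 S) := by
    have h := hm.inv
    rw [inv_one] at h
    have h' := ENNReal.Tendsto.mul h (Or.inl one_ne_zero) hB (Or.inr ENNReal.one_ne_top)
    rwa [one_mul] at h'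
  exact (closedEnergy_le_liminf v hΘΨ).trans ((liminf_le_liminf hEΘ).trans hlim.liminf_eq.le)

end HardSphereClosedEnergy

/-- **Stub 2b-D `stub_hardSphereClosedEnergy` of line `birth` — maximal form = minimal form for
Dirichlet hard spheres.** For `R > 0` and a measurable `N`-body function `Ψ` vanishing a.e. on the
core set `{∃ i ≠ j, |xᵢ - xⱼ| ≤ R}`, the closed (relaxed from the symmetric `C¹` Dirichlet core)
hard-sphere energy is at most the closed free energy:
`closedEnergy (⊤ · 1_{(-∞,R]}) L Ψ ≤ closedEnergy 0 L Ψ`. The hard-sphere profile is measurable,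
`= ⊤` on `[0, R]` and `= 0` beyond `R`, so `HardSphereClosedEnergy.closedEnergy_le_of_ae_vanish`
applies. [cite: Kato1966, VI §1.3 Thm 1.16] -/
theorem stub_hardSphereClosedEnergy :
    ∀ (N : ℕ) (L R : ℝ), 0 < R →
      ∀ Ψ : Literature.MathematicalPhysics.QuantumManyBody.BoseGas.Config N → ℂ, Measurable Ψ →
        (∀ᵐ X : Literature.MathematicalPhysics.QuantumManyBody.BoseGas.Config N,
            (∃ i j : Fin N, i ≠ j ∧ dist (X i) (X j) ≤ R) → Ψ X = 0) →
          Literature.MathematicalPhysics.QuantumManyBody.BoseGas.closedEnergy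
              (Set.indicator (Set.Iic R) (fun _ : ℝ => (⊤ : ENNReal))) L Ψ ≤
            Literature.MathematicalPhysics.QuantumManyBody.BoseGas.closedEnergy 0 L Ψ := by
  intro N L R hR Ψ hΨ hcoreΨ
  refine HardSphereClosedEnergy.closedEnergy_le_of_ae_vanish hR
    (measurable_const.indicator measurableSet_Iic) (fun t ht => ?_) (fun t ht => ?_) hΨ hcoreΨ
  · exact indicator_of_mem (show t ∈ Set.Iic R from ht.2) _
  · exact indicator_of_notMem (show t ∉ Set.Iic R from not_le.2 ht) _

end Summit.AtomisticToContinuum.BoseEinsteinCondensation.Cruxes.HardCoreDominates.Birth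

end
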